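import Literature.NumberTheory.GaloisRepresentations.PowerSeriesTopNilpotentIntertwine
import Mathlib.RingTheory.PowerSeries.WeierstrassPreparation
import HarnessLib

/-!
# Zeros of the `(p)`-adic evaluation `tEval`: a non-zero power series over a complete discrete valuation ring has only FINITELY
# many zeros `a ∈ (p)` — so power series (characteristic power series, `Λ`-linear functionals) are SEPARATED by infinitely many weights

Washington, *Introduction to Cyclotomic Fields* (1997), §7.1 Thm. 7.3 (Weierstrass preparation: `g = P·u`, `P` distinguished, `u ∈ Λ^×`)
and its standard corollary ("a nonzero power series has only finitely many zeros in the maximal ideal"; Prop. 7.2 / Lemma 13.?; de Shalit,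
*Iwasawa theory of elliptic curves with complex multiplication* (1987), Ch. I §3.1, III §1.11 (18): a characteristic power series vanishes at
the characters `ε = χρ` that are "the reciprocals of the zeroes of the `p`-adic `L` functions" — finitely many).  The prequel
`PowerSeriesTopNilpotentIntertwine` defined the `(p)`-adic evaluation `tEval ha : S⟦T⟧ →+* S`, `T ↦ a ∈ (p)` (the value `c(a) = Σ c_k a^k` through
which the weight specialisations of the Coleman coordinate module are read, `LubinTateColemanCoordMomentsLinearTwo`).  THIS file proves, with
Mathlib's Weierstrass preparation (`PowerSeries.eq_weierstrassDistinguished_mul_weierstrassUnit`), everything below (0 sorry, no definitions):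

* §1 `tEval_coe` (**on polynomials `tEval` is `Polynomial.eval`**), `tEval_sub_constantCoeff_mem` (`c(a) ≡ c(0) (mod p)`),
  ★ `isUnit_tEval_of_isUnit_constantCoeff` (**`u(0) ∈ A^× ⟹ u(a) ∈ A^×`** for `p ∈ 𝔪_A`, `A` local);
* §2 (`A` a complete local domain, `c ∉ 𝔪⟦T⟧`) `tEval_eq_eval_weierstrassDistinguished_mul`, ★ `tEval_eq_zero_iff_isRoot_weierstrassDistinguished`
  (**`c(a) = 0 ↔ P(a) = 0`**, `c = P·u` the Weierstrass factorisation), ★ `finite_setOf_tEval_eq_zero_of_map_residue_ne_zero`;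
* §3 (`𝔪_A = (p)`, `p ≠ 0`: a complete DVR with uniformiser `p`) `exists_eq_C_mul_of_forall_coeff_mem`, ★ `exists_eq_C_pow_mul_of_ne_zero`
  (**`c ≠ 0 ⟹ c = p^m·c₀` with `c₀ ∉ 𝔪⟦T⟧`**), ★★ **`finite_setOf_tEval_eq_zero`** (a NON-ZERO power series has finitely many zeros in `(p)`),
  ★★ `eq_zero_of_infinite_setOf_tEval_eq_zero` / `eq_zero_of_forall_tEval_apply_eq_zero` (vanishing at infinitely many / at an injective sequence of
  points of `(p)` forces `c = 0`) and `eq_of_forall_tEval_apply_eq` (**two power series with the same values at infinitely many weights are EQUAL**).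

This is the separation half of the junction (J-i) of the Coleman lane: a `Λ`-linear map out of a free `Λ`-module (or an element of `Λ[Δ]`) is
pinned by its specialisations at infinitely many weights `a_k = γ^{k+1} − 1`.

## References
* L. C. Washington, *Introduction to Cyclotomic Fields*, 2nd ed. (1997), §7.1 (Prop. 7.2, Thm. 7.3), §13.2. [Washington1997]
* E. de Shalit, *Iwasawa theory of elliptic curves with complex multiplication* (1987), Ch. I §3.1; Ch. III §1.11 (18). [deShalit1987]
-/

noncomputable section

namespace Literature.NumberTheory.GaloisRepresentations

namespace LubinTate

open Finset PowerSeries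

variable {A : Type*} [CommRing A] {p : A} [IsAdicComplete (Ideal.span {p}) A] {a : A} (ha : a ∈ Ideal.span {p})

/-! ### §1. `tEval` on polynomials, modulo `p`, on units -/

/-- **On a polynomial `P`, `tEval` is `Polynomial.eval`**: `P(a) = Σ_{i ≤ deg P} P_i a^i`. [cite: Washington1997, §7.1] -/
theorem tEval_coe (P : Polynomial A) : tEval ha (P : PowerSeries A) = P.eval a := by
  rw [tEval_eq_sum_of_coeff_eq_zero ha (K₀ := P.natDegree + 1)
      (fun k hk => by rw [Polynomial.coeff_coe]; exact Polynomial.coeff_eq_zero_of_natDegree_lt (by omega)),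
    Polynomial.eval_eq_sum_range]
  exact sum_congr rfl fun k _ => by rw [Polynomial.coeff_coe]

/-- `c(a) ≡ c(0) (mod p)`. [cite: Washington1997, §7.1] -/
theorem tEval_sub_constantCoeff_mem (c : PowerSeries A) : tEval ha c - PowerSeries.constantCoeff c ∈ Ideal.span {p} := by
  have h := tEval_sub_sum_mem ha c 1
  rwa [sum_range_one, pow_zero, mul_one, pow_one, PowerSeries.coeff_zero_eq_constantCoeff] at h

/-- `tEval (C s * c) = s * c(a)`. [cite: Washington1997, §7.1] -/
theorem tEval_C_mul (s : A) (c : PowerSeries A) : tEval ha (PowerSeries.C s * c) = s * tEval ha c := by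
  rw [tEval_mul, tEval_C]

/-- ★ **`u(0) ∈ A^× ⟹ u(a) ∈ A^×`** when `p` lies in the maximal ideal of the local ring `A` (`u(a) = u(0) + (p)`-element).
[cite: Washington1997, §7.1] -/
theorem isUnit_tEval_of_isUnit_constantCoeff [IsLocalRing A] (hp : p ∈ IsLocalRing.maximalIdeal A) {u : PowerSeries A}
    (hu : IsUnit (PowerSeries.constantCoeff u)) : IsUnit (tEval ha u) := by
  by_contra hnu
  have hmem : tEval ha u ∈ IsLocalRing.maximalIdeal A := (IsLocalRing.mem_maximalIdeal _).mpr (mem_nonunits_iff.mpr hnu)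
  have hsub : tEval ha u - PowerSeries.constantCoeff u ∈ IsLocalRing.maximalIdeal A :=
    (Ideal.span_singleton_le_iff_mem (IsLocalRing.maximalIdeal A)).mpr hp (tEval_sub_constantCoeff_mem ha u)
  have h0 : PowerSeries.constantCoeff u ∈ IsLocalRing.maximalIdeal A := by
    have h := sub_mem hmem hsub
    rwa [sub_sub_cancel] at h
  exact mem_nonunits_iff.mp ((IsLocalRing.mem_maximalIdeal _).mp h0) hu

/-! ### §2. `c ∉ 𝔪⟦T⟧`: the zeros of `c(a)` are the roots of its Weierstrass polynomial -/

section Weierstrass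

variable [IsLocalRing A] [IsAdicComplete (IsLocalRing.maximalIdeal A) A] (hp : p ∈ IsLocalRing.maximalIdeal A)

/-- **`c(a) = P(a) · u(a)`** for the Weierstrass factorisation `c = P · u` (`P` distinguished, `u` a unit). [cite: Washington1997, §7.1 Thm. 7.3] -/
theorem tEval_eq_eval_weierstrassDistinguished_mul {c : PowerSeries A} (hc : c.map (IsLocalRing.residue A) ≠ 0) :
    tEval ha c = (c.weierstrassDistinguished hc).eval a * tEval ha (c.weierstrassUnit hc) := by
  conv_lhs => rw [c.eq_weierstrassDistinguished_mul_weierstrassUnit hc]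
  rw [tEval_mul, tEval_coe]

include hp in
/-- The Weierstrass unit evaluates to a unit: `u(a) ∈ A^×`. [cite: Washington1997, §7.1 Thm. 7.3] -/
theorem isUnit_tEval_weierstrassUnit {c : PowerSeries A} (hc : c.map (IsLocalRing.residue A) ≠ 0) :
    IsUnit (tEval ha (c.weierstrassUnit hc)) :=
  isUnit_tEval_of_isUnit_constantCoeff ha hp (PowerSeries.isUnit_iff_constantCoeff.mp (c.isUnit_weierstrassUnit hc))

include hp in
/-- ★ **`c(a) = 0 ↔ P(a) = 0`** (`A` a domain): the zeros of `c` in `(p)` are roots of its distinguished polynomial. [cite: Washington1997, §7.1] -/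
theorem tEval_eq_zero_iff_isRoot_weierstrassDistinguished [IsDomain A] {c : PowerSeries A} (hc : c.map (IsLocalRing.residue A) ≠ 0) :
    tEval ha c = 0 ↔ (c.weierstrassDistinguished hc).IsRoot a := by
  rw [tEval_eq_eval_weierstrassDistinguished_mul ha hc, mul_eq_zero, or_iff_left (isUnit_tEval_weierstrassUnit ha hp hc).ne_zero,
    Polynomial.IsRoot.def]

include hp in
/-- ★ **Finitely many zeros** for `c ∉ 𝔪⟦T⟧` (`A` a complete local domain): `{a ∈ (p) : c(a) = 0}` lies in the root set of the distinguished
polynomial. [cite: Washington1997, §7.1] -/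
theorem finite_setOf_tEval_eq_zero_of_map_residue_ne_zero [IsDomain A] {c : PowerSeries A} (hc : c.map (IsLocalRing.residue A) ≠ 0) :
    {x : A | ∃ hx : x ∈ Ideal.span {p}, tEval hx c = 0}.Finite := by
  classical
  refine (c.weierstrassDistinguished hc).roots.toFinset.finite_toSet.subset ?_
  rintro x ⟨hx, h0⟩
  rw [Finset.mem_coe, Multiset.mem_toFinset, Polynomial.mem_roots (c.isDistinguishedAt_weierstrassDistinguished hc).monic.ne_zero]
  exact (tEval_eq_zero_iff_isRoot_weierstrassDistinguished hx hp hc).mp h0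

include hp in
/-- The number of zeros in `(p)` of `c ∉ 𝔪⟦T⟧` is at most the degree of its distinguished polynomial (= the reduced order of `c`, the
`λ`-invariant). [cite: Washington1997, §7.1] -/
theorem ncard_setOf_tEval_eq_zero_le [IsDomain A] {c : PowerSeries A} (hc : c.map (IsLocalRing.residue A) ≠ 0) :
    {x : A | ∃ hx : x ∈ Ideal.span {p}, tEval hx c = 0}.ncard ≤ (c.weierstrassDistinguished hc).natDegree := by
  classical
  have hsub : {x : A | ∃ hx : x ∈ Ideal.span {p}, tEval hx c = 0} ⊆ ((c.weierstrassDistinguished hc).roots.toFinset : Set A) := by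
    rintro x ⟨hx, h0⟩
    rw [Finset.mem_coe, Multiset.mem_toFinset, Polynomial.mem_roots (c.isDistinguishedAt_weierstrassDistinguished hc).monic.ne_zero]
    exact (tEval_eq_zero_iff_isRoot_weierstrassDistinguished hx hp hc).mp h0
  refine (Set.ncard_le_ncard hsub (Finset.finite_toSet _)).trans ?_
  rw [Set.ncard_coe_finset]
  exact (Multiset.toFinset_card_le _).trans (Polynomial.card_roots' _)

end Weierstrass

/-! ### §3. `𝔪_A = (p)`: factoring out `p`, finiteness of zeros for every `c ≠ 0`, separation -/

omit [IsAdicComplete (Ideal.span {p}) A] in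
/-- If every coefficient of `c` lies in `(p)` then `c = C p · c′`. [cite: Washington1997, §7.1] -/
theorem exists_eq_C_mul_of_forall_coeff_mem {c : PowerSeries A} (h : ∀ n, PowerSeries.coeff n c ∈ Ideal.span {p}) :
    ∃ c' : PowerSeries A, c = PowerSeries.C p * c' := by
  choose d hd using fun n => Ideal.mem_span_singleton'.mp (h n)
  refine ⟨PowerSeries.mk d, PowerSeries.ext fun n => ?_⟩
  rw [PowerSeries.coeff_C_mul, PowerSeries.coeff_mk, mul_comm, hd]

section DVR

variable [IsLocalRing A] (h𝔪 : IsLocalRing.maximalIdeal A = Ideal.span {p})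

omit [IsAdicComplete (Ideal.span {p}) A] in
include h𝔪 in
/-- `p ∈ 𝔪_A` when `𝔪_A = (p)`. [cite: Washington1997, §7.1] -/
theorem mem_maximalIdeal_of_eq_span : p ∈ IsLocalRing.maximalIdeal A := by
  rw [h𝔪]; exact Ideal.mem_span_singleton_self p

include h𝔪 in
/-- ★ **`c ≠ 0 ⟹ c = p^m · c₀` with `c₀ ∉ 𝔪⟦T⟧`** (`𝔪_A = (p)`, `A` `(p)`-adically separated): factor out the largest power of `p` dividing
all coefficients. [cite: Washington1997, §7.1 (Lemma 7.5 / μ-invariant)] -/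
theorem exists_eq_C_pow_mul_of_ne_zero {c : PowerSeries A} (hc : c ≠ 0) :
    ∃ (m : ℕ) (c₀ : PowerSeries A), c = PowerSeries.C (p ^ m) * c₀ ∧ c₀.map (IsLocalRing.residue A) ≠ 0 := by
  obtain ⟨n₀, hn₀⟩ : ∃ n, PowerSeries.coeff n c ≠ 0 :=
    not_forall.mp fun h => hc (PowerSeries.ext fun n => by rw [h n, map_zero])
  obtain ⟨k, hk⟩ : ∃ k, PowerSeries.coeff n₀ c ∉ Ideal.span {p ^ k} :=
    not_forall.mp fun h => hn₀ (IsHausdorff.haus' (I := Ideal.span {p}) _ fun K => by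
      rw [SModEq.sub_mem, sub_zero, smul_eq_mul, Ideal.mul_top, Ideal.span_singleton_pow]; exact h K)
  have key : ∀ (k : ℕ) (c : PowerSeries A), PowerSeries.coeff n₀ c ∉ Ideal.span {p ^ k} →
      ∃ (m : ℕ) (c₀ : PowerSeries A), c = PowerSeries.C (p ^ m) * c₀ ∧ ∃ n, PowerSeries.coeff n c₀ ∉ Ideal.span {p} := by
    intro k
    induction k with
    | zero =>
      intro c hc0
      exact absurd (by rw [pow_zero, Ideal.span_singleton_one]; exact Submodule.mem_top) hc0
    | succ k ih =>
      intro c hck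
      by_cases hall : ∀ n, PowerSeries.coeff n c ∈ Ideal.span {p}
      · obtain ⟨c', hc'⟩ := exists_eq_C_mul_of_forall_coeff_mem hall
        have hc'k : PowerSeries.coeff n₀ c' ∉ Ideal.span {p ^ k} := by
          intro hmem
          apply hck
          obtain ⟨d, hd⟩ := Ideal.mem_span_singleton'.mp hmem
          rw [hc', PowerSeries.coeff_C_mul, ← hd]
          exact Ideal.mem_span_singleton'.mpr ⟨d, by rw [pow_succ]; ring⟩
        obtain ⟨m, c₀, hc₀, hn⟩ := ih c' hc'k
        exact ⟨m + 1, c₀, by rw [hc', hc₀, ← mul_assoc, ← map_mul, ← pow_succ'], hn⟩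
      · obtain ⟨n, hn⟩ := not_forall.mp hall
        exact ⟨0, c, by rw [pow_zero, map_one, one_mul], n, hn⟩
  obtain ⟨m, c₀, hc₀, n, hn⟩ := key k c hk
  refine ⟨m, c₀, hc₀, fun h0 => hn ?_⟩
  have h := congrArg (PowerSeries.coeff n) h0
  rw [PowerSeries.coeff_map, map_zero, IsLocalRing.residue_eq_zero_iff, h𝔪] at h
  exact h

variable [IsAdicComplete (IsLocalRing.maximalIdeal A) A] [IsDomain A]

include h𝔪 in
/-- ★★ **A NON-ZERO power series over a complete discrete valuation ring has FINITELY MANY zeros in `(p)`** (`𝔪_A = (p)`, `p ≠ 0`).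
[cite: Washington1997, §7.1 (Prop. 7.2, Thm. 7.3)] [cite: deShalit1987, Ch. III §1.11] -/
theorem finite_setOf_tEval_eq_zero (hp0 : p ≠ 0) {c : PowerSeries A} (hc : c ≠ 0) :
    {x : A | ∃ hx : x ∈ Ideal.span {p}, tEval hx c = 0}.Finite := by
  obtain ⟨m, c₀, hc₀, hres⟩ := exists_eq_C_pow_mul_of_ne_zero h𝔪 hc
  refine (finite_setOf_tEval_eq_zero_of_map_residue_ne_zero (mem_maximalIdeal_of_eq_span h𝔪) hres).subset ?_
  rintro x ⟨hx, h0⟩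
  refine ⟨hx, ?_⟩
  rw [hc₀, tEval_C_mul] at h0
  exact (mul_eq_zero.mp h0).resolve_left (pow_ne_zero m hp0)

include h𝔪 in
/-- ★★ **SEPARATION**: a power series vanishing at infinitely many points of `(p)` is `0`. [cite: Washington1997, §7.1] [cite: deShalit1987, Ch. III §1.11] -/
theorem eq_zero_of_infinite_setOf_tEval_eq_zero (hp0 : p ≠ 0) {c : PowerSeries A}
    (hinf : {x : A | ∃ hx : x ∈ Ideal.span {p}, tEval hx c = 0}.Infinite) : c = 0 := by
  by_contra hc
  exact hinf (finite_setOf_tEval_eq_zero h𝔪 hp0 hc)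

include h𝔪 in
/-- ★★ **Sequence form**: if `c(a_n) = 0` for an INJECTIVE sequence `a : ℕ → (p)` (e.g. the weights `a_k = γ^{k+1} − 1`), then `c = 0`.
[cite: Washington1997, §7.1, §13.2] -/
theorem eq_zero_of_forall_tEval_apply_eq_zero (hp0 : p ≠ 0) {c : PowerSeries A} {x : ℕ → A} (hx : ∀ n, x n ∈ Ideal.span {p})
    (hinj : Function.Injective x) (h0 : ∀ n, tEval (hx n) c = 0) : c = 0 :=
  eq_zero_of_infinite_setOf_tEval_eq_zero h𝔪 hp0 (Set.infinite_of_injective_forall_mem hinj fun n => ⟨hx n, h0 n⟩)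

include h𝔪 in
/-- **Infinitely many indices suffice**: if `c(a_n) = 0` for all `n` in an infinite set of indices of an injective sequence `a : ℕ → (p)`, then
`c = 0`. [cite: Washington1997, §7.1, §13.2] -/
theorem eq_zero_of_infinite_setOf_tEval_apply_eq_zero (hp0 : p ≠ 0) {c : PowerSeries A} {x : ℕ → A} (hx : ∀ n, x n ∈ Ideal.span {p})
    (hinj : Function.Injective x) (hinf : {n : ℕ | tEval (hx n) c = 0}.Infinite) : c = 0 := by
  refine eq_zero_of_infinite_setOf_tEval_eq_zero h𝔪 hp0 ((hinf.image hinj.injOn).mono ?_)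
  rintro y ⟨n, hn, rfl⟩
  exact ⟨hx n, hn⟩

include h𝔪 in
/-- ★★ **Two power series with the same values at an injective sequence of points of `(p)` are EQUAL** (the identity principle for
`tEval`; e.g. two `Λ`-linear functionals agreeing at infinitely many weights). [cite: Washington1997, §7.1, §13.2] -/
theorem eq_of_forall_tEval_apply_eq (hp0 : p ≠ 0) {c c' : PowerSeries A} {x : ℕ → A} (hx : ∀ n, x n ∈ Ideal.span {p})
    (hinj : Function.Injective x) (h : ∀ n, tEval (hx n) c = tEval (hx n) c') : c = c' := by
  refine sub_eq_zero.mp (eq_zero_of_forall_tEval_apply_eq_zero h𝔪 hp0 hx hinj fun n => ?_)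
  rw [← tEvalHom_apply, map_sub, tEvalHom_apply, tEvalHom_apply, h n, sub_self]

include h𝔪 in
/-- Infinitely-many-indices form of the identity principle. [cite: Washington1997, §7.1, §13.2] -/
theorem eq_of_infinite_setOf_tEval_apply_eq (hp0 : p ≠ 0) {c c' : PowerSeries A} {x : ℕ → A} (hx : ∀ n, x n ∈ Ideal.span {p})
    (hinj : Function.Injective x) (hinf : {n : ℕ | tEval (hx n) c = tEval (hx n) c'}.Infinite) : c = c' := by
  refine sub_eq_zero.mp (eq_zero_of_infinite_setOf_tEval_apply_eq_zero h𝔪 hp0 hx hinj (hinf.mono fun n hn => ?_))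
  change tEval (hx n) c = tEval (hx n) c' at hn
  change tEval (hx n) (c - c') = 0
  rw [← tEvalHom_apply, map_sub, tEvalHom_apply, tEvalHom_apply, hn, sub_self]

end DVR

end LubinTate

end Literature.NumberTheory.GaloisRepresentations
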